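import Summits.SmoothPoincare4.SmoothPoincare4.Theses.WeakReductionDescent
import Literature.Topology.FourManifolds.SphereTrisectionsSectors
import Literature.Topology.FourManifolds.TrisectionFunctorGKNaturality

/-!
# Crux `WeakReductionDescent.MinimalWeaklyReducible` (stmt-SmoothPoincare4-17907) — line `rung-split`
# (crux-strategist s1, 2026-08-17): the rung-3 piece re-typed as a DEPENDENT TRIPLE (Aranda–Zupan 2025, Thm 1.4)

`MinimalWeaklyReducible ⇐ DependentTripleAtThree ∧ DependentTripleGenusThreeStandard ∧ MinimalWeaklyReducibleFromFour`.

The crux K1 ("every minimal-genus GK-trisection of genus `g ≥ 3` of a smooth homotopy 4-sphere is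
weakly reducible") is the conjunction of its rungs `g₀ ≥ 3` (refuter's `BirthAttack.lean`,
`minimalWeaklyReducible_iff_forall_at`), and at the first rung the weak-reduction vocabulary is
costume: modulo the route's support `GenusThreeBase` (= AZ25 Thm 1.3), K1 at genus `3` is
EQUIVALENT to "no smooth homotopy 4-sphere has minimal trisection genus `3`", the `(3;1,1,1)`
frontier of `Literature.Barriers.SmoothPoincare4.LowGenusTrisectionBarrier`
(`BirthAttack.minimalWeaklyReducibleAt_three_iff`).  This line files the rung-3 piece in the
WEAKEST certificate form the 2025 literature supports and isolates the literature theorem: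

* `stub_dependentTripleAtThree` (X₁, crux-strength, SPC4-shielded like K1): every MINIMAL genus-`3`
  GK-trisection of a smooth homotopy 4-sphere admits a DEPENDENT TRIPLE — three pairwise disjoint
  non-separating smoothly embedded circles `a, b, c` on the central surface `F`, bounding properly
  embedded smooth discs in the three handlebodies `H 0, H 1, H 2` respectively, whose union
  SEPARATES `F` (for pairwise disjoint non-separating simple closed curves on a closed orientable
  surface, "`[a], [b], [c]` linearly dependent in `H₁(F)`" — AZ25 §7, p. 24 — is equivalent to
  "`F ∖ (a ∪ b ∪ c)` is disconnected": a complementary region's boundary is a signed sum of the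
  curves it sees from one side; conversely a connected complement gives dual curves).  A weak
  reduction `(c ⊂ H_p; c′ ⊂ H_q, H_r)` gives the dependent triple `(c, c′, push-off of c′)`
  (AZ25 §7 case (1)), so X₁ is implied by K1 at genus 3 and is a WIDER certificate: AZ25 §7 case
  (3) — `a, b, c` co-bounding a pair of pants, no two homologous — is not a weak reduction.
* `stub_dependentTripleStandard` (X_F, support, named-fact grade): Aranda–Zupan 2025 Thm 1.4 /
  Cor 1.5, homotopy-sphere corollary over the Statement's bare binders: a smooth `M ≃ₕ S⁴` with a
  genus-`3` GK-trisection admitting a dependent triple is diffeomorphic to `S⁴` (printed: "`X` is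
  diffeomorphic to `S_p`, `S′_p`, or a connected sum of copies of `±ℂP²` and `S² × S²`", p. 26;
  `π₁ = 1`, `H₂ = 0` leave `S_1 = S′_1 = S⁴`).  To be vendored next to
  `Literature.Topology.FourManifolds.arandaZupan_genus_three_weaklyReducible_homotopySphere_gk`.
* `stub_fromFour` (X₂, crux-strength): K1 verbatim for `4 ≤ g` — the remaining rungs, where the
  route genuinely consumes weak reducibility (crux K2 `WeakReductionReduces` starts at `g ≥ 4`).

Composition `MinimalWeaklyReducible_of` = `minimalWeaklyReducible_of_pieces stub₁ stub₂ stub₃` (the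
glue `minimalWeaklyReducible_of_pieces : X₁ → X_F → X₂ → K1` is sorry-free): at `g = 3`, X₁ gives a dependent triple,
X_F a diffeomorphism `Φ : M ≅ S⁴`, and Gay–Kirby's genus-`0` trisection of `S⁴`
(`sphere_genusZero_gkTrisection_holds`, PROVED) transported along `Φ⁻¹`
(`IsGKTrisection.image_diffeomorph'`, PROVED) contradicts minimality (`3 ≤ 0`), so the rung is
vacuous; at `g ≥ 4`, X₂.  EXACTNESS (the split loses nothing, modulo the two AZ25 theorems):
`fromFour_of_minimalWeaklyReducible` (restriction) and
`dependentTripleAtThree_of_minimalWeaklyReducible` (K1 ∧ GenusThreeBase empty the rung, so X₁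
holds vacuously) are proved below.

Honours `BirthAttack.wr_false_without_trisection` (every stub keeps `IsGKTrisection`), the
`k_p ≥ 1` semantics (genus 3 for a homotopy sphere is type `(3;1,1,1)`,
`Literature.Barriers.SmoothPoincare4.exotic_trisection_constraints`), and
`minimalWeaklyReducibleAt_three_iff` (it is the reason for the cut).  No `Disproof.lean` exists
for this crux (2026-08-17).
-/

noncomputable section

set_option linter.dupNamespace false

open scoped Manifold ContDiff Topology ContinuousMap
open Set
open Literature.Topology.FourManifolds
open Summit.SmoothPoincare4.SmoothPoincare4.Theses.WeakReductionDescent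

namespace Summit.SmoothPoincare4.SmoothPoincare4.Cruxes.MinimalWeaklyReducible.RungSplit

/-! ## The three stubs (registered; each is to become a route item under K1) -/

/-- **X₁ — `DependentTripleAtThree` (crux-strength).** Every minimal genus-`3` GK-trisection of a
smooth homotopy 4-sphere admits a dependent triple (AZ25 §7): pairwise disjoint non-separating
curves `a, b, c ⊆ F`, compressing in `H 0`, `H 1`, `H 2` respectively, whose union separates `F`. -/
theorem stub_dependentTripleAtThree :
    ∀ (M : Type) [TopologicalSpace M] [T2Space M] [SecondCountableTopology M] [ChartedSpace (EuclideanSpace ℝ (Fin 4)) M] [IsManifold (𝓡 4) ((⊤ : ℕ∞) : WithTop ℕ∞) M], (M ≃ₕ (Metric.sphere (0 : EuclideanSpace ℝ (Fin 5)) 1)) → ∀ (k : Fin 3 → ℕ) (T : Fin 3 → Set M), Literature.Topology.FourManifolds.IsGKTrisection M 3 k T → (∀ (g' : ℕ) (k' : Fin 3 → ℕ) (T' : Fin 3 → Set M), Literature.Topology.FourManifolds.IsGKTrisection M g' k' T' → 3 ≤ g') → (let F : Set M := ⋂ l, T l; let H : Fin 3 → Set M := fun p => ⋂ (l : Fin 3)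 (_ : l ≠ p), T l; let IsCurve : Set M → Prop := fun c => c ⊆ F ∧ ∃ γ : (Metric.sphere (0 : EuclideanSpace ℝ (Fin 2)) 1) → M, Manifold.IsSmoothEmbedding (𝓡 1) (𝓡 4) ((⊤ : ℕ∞) : WithTop ℕ∞) γ ∧ Set.range γ = c; let BoundsDisc : Set M → Set M → Prop := fun A c => ∃ d : (Metric.closedBall (0 : EuclideanSpace ℝ (Fin 2)) 1) → M, Manifold.IsSmoothEmbedding (𝓡∂ 2) (𝓡 4) ((⊤ : ℕ∞) : WithTop ℕ∞) d ∧ Set.range d ⊆ A ∧ d '' ((𝓡∂ 2).boundary (Metric.closedBall (0 : EuclideanSpace ℝ (Fin 2)) 1)) = c ∧ Set.range d ∩ F = c; let NonSep : Set M → Prop := fun c => IsConnected (F \ c); let DependentTriple : Prop := ∃ (a b c : Set M), IsCurve a ∧ IsCurve b ∧ IsCurve c ∧ Disjoint a b ∧ Disjoint b c ∧ Disjoint a c ∧ NonSep a ∧ NonSep b ∧ NonSep c ∧ BoundsDisc (H 0) a ∧ BoundsDisc (H 1) b ∧ BoundsDisc (H 2) c ∧ ¬ IsPreconnected (F \ (a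 ∪ b ∪ c)); DependentTriple) := by
  sorry

/-- **X_F — `DependentTripleGenusThreeStandard` (support, named-fact grade: AZ25 Thm 1.4 / Cor 1.5,
homotopy-sphere corollary).** A smooth homotopy 4-sphere (bare binders, `e : M ≃ₕ S⁴`) with a
genus-`3` GK-trisection admitting a dependent triple is diffeomorphic to `S⁴`. -/
theorem stub_dependentTripleStandard :
    ∀ (M : Type) [TopologicalSpace M] [T2Space M] [SecondCountableTopology M] [ChartedSpace (EuclideanSpace ℝ (Fin 4)) M] [IsManifold (𝓡 4) ((⊤ : ℕ∞) : WithTop ℕ∞) M], (M ≃ₕ (Metric.sphere (0 : EuclideanSpace ℝ (Fin 5)) 1)) → ∀ (k : Fin 3 → ℕ) (T : Fin 3 → Set M), Literature.Topology.FourManifolds.IsGKTrisection M 3 k T → (let F : Set M := ⋂ l, T l; let H : Fin 3 → Set M := fun p => ⋂ (l : Fin 3) (_ : l ≠ p), T l; let IsCurve : Set M → Prop := fun c => c ⊆ F ∧ ∃ γ : (Metric.sphere (0 : EuclideanSpace ℝ (Fin 2)) 1) → M, Manifold.IsSmoothEmbedding (𝓡 1) (𝓡 4) ((⊤ : ℕ∞)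 : WithTop ℕ∞) γ ∧ Set.range γ = c; let BoundsDisc : Set M → Set M → Prop := fun A c => ∃ d : (Metric.closedBall (0 : EuclideanSpace ℝ (Fin 2)) 1) → M, Manifold.IsSmoothEmbedding (𝓡∂ 2) (𝓡 4) ((⊤ : ℕ∞) : WithTop ℕ∞) d ∧ Set.range d ⊆ A ∧ d '' ((𝓡∂ 2).boundary (Metric.closedBall (0 : EuclideanSpace ℝ (Fin 2)) 1)) = c ∧ Set.range d ∩ F = c; let NonSep : Set M → Prop := fun c => IsConnected (F \ c); let DependentTriple : Prop := ∃ (a b c : Set M), IsCurve a ∧ IsCurve b ∧ IsCurve c ∧ Disjoint a b ∧ Disjoint b c ∧ Disjoint a c ∧ NonSep a ∧ NonSep b ∧ NonSep c ∧ BoundsDisc (H 0) a ∧ BoundsDisc (H 1) b ∧ BoundsDisc (H 2) c ∧ ¬ IsPreconnected (F \ (a ∪ b ∪ c)); DependentTriple) → Nonempty (Diffeomorph (𝓡 4) (𝓡 4) M (Metric.sphere (0 : EuclideanSpace ℝ (Fin 5)) 1) ((⊤ : ℕ∞) : WithTop ℕ∞)) := by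
  sorry

/-- **X₂ — `MinimalWeaklyReducibleFromFour` (crux-strength).** K1 verbatim for `4 ≤ g`: every
minimal GK-trisection of genus `g ≥ 4` of a smooth homotopy 4-sphere is weakly reducible. -/
theorem stub_fromFour :
    ∀ (M : Type) [TopologicalSpace M] [T2Space M] [SecondCountableTopology M] [ChartedSpace (EuclideanSpace ℝ (Fin 4)) M] [IsManifold (𝓡 4) ((⊤ : ℕ∞) : WithTop ℕ∞) M], (M ≃ₕ (Metric.sphere (0 : EuclideanSpace ℝ (Fin 5)) 1)) → ∀ (g : ℕ) (k : Fin 3 → ℕ) (T : Fin 3 → Set M), Literature.Topology.FourManifolds.IsGKTrisection M g k T → 4 ≤ g → (∀ (g' : ℕ) (k' : Fin 3 → ℕ) (T' : Fin 3 → Set M), Literature.Topology.FourManifolds.IsGKTrisection M g' k' T' → g ≤ g') → (let F : Set M := ⋂ l, T l; let H : Fin 3 → Set M := fun p => ⋂ (l : Fin 3) (_ : l ≠ p), T l; let IsCurve : Set M → Prop := fun c => c ⊆ F ∧ ∃ γ : (Metric.sphere (0 : EuclideanSpace ℝ (Fin 2)) 1) → M, Manifold.IsSmoothEmbedding (𝓡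 1) (𝓡 4) ((⊤ : ℕ∞) : WithTop ℕ∞) γ ∧ Set.range γ = c; let BoundsDisc : Set M → Set M → Prop := fun A c => ∃ d : (Metric.closedBall (0 : EuclideanSpace ℝ (Fin 2)) 1) → M, Manifold.IsSmoothEmbedding (𝓡∂ 2) (𝓡 4) ((⊤ : ℕ∞) : WithTop ℕ∞) d ∧ Set.range d ⊆ A ∧ d '' ((𝓡∂ 2).boundary (Metric.closedBall (0 : EuclideanSpace ℝ (Fin 2)) 1)) = c ∧ Set.range d ∩ F = c; let NonSep : Set M → Prop := fun c => IsConnected (F \ c); let WeaklyReducible : Prop := ∃ (p : Fin 3) (c c' : Set M), IsCurve c ∧ IsCurve c' ∧ Disjoint c c' ∧ NonSep c ∧ NonSep c' ∧ BoundsDisc (H p) c ∧ ∀ q : Fin 3, q ≠ p → BoundsDisc (H q) c'; WeaklyReducible) := by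
  sorry

/-! ## The composition, sorry-free, concluding the crux BY NAME -/

/-- Local notation: the round `4`-sphere. -/
local notation "𝕊⁴" => (Metric.sphere (0 : EuclideanSpace ℝ (Fin 5)) 1)

/-- A diffeomorphism to the round sphere makes every genus `≥ 1` non-minimal: Gay–Kirby's
genus-`0` trisection of `S⁴` pulls back. [folklore] -/
theorem not_minimal_of_diffeomorph {M : Type} [TopologicalSpace M]
    [ChartedSpace (EuclideanSpace ℝ (Fin 4)) M] [IsManifold (𝓡 4) ∞ M]
    (Φ : M ≃ₘ⟮𝓡 4, 𝓡 4⟯ 𝕊⁴) {g : ℕ} (hg : 1 ≤ g)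
    (hmin : ∀ (g' : ℕ) (k' : Fin 3 → ℕ) (T' : Fin 3 → Set M), IsGKTrisection M g' k' T' → g ≤ g') :
    False := by
  obtain ⟨S₀, hS₀⟩ := sphere_genusZero_gkTrisection_holds
  have h0 := hmin 0 (fun _ => 0) (fun i => Φ.symm '' S₀ i) (hS₀.isGKTrisection.image_diffeomorph' Φ.symm)
  omega

/-- **`minimalWeaklyReducible_of_pieces` : X₁ → X_F → X₂ → K1** (pure logic + two proved tree
facts; this is the GLUE of the route-level split, Theorems-ready).  At `g = 3` the dependent
triple (X₁) and AZ25 Thm 1.4 (X_F) give `M ≅ S⁴`, contradicting minimality, so the rung is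
vacuous; at `g ≥ 4`, X₂ verbatim. -/
theorem minimalWeaklyReducible_of_pieces :
    (∀ (M : Type) [TopologicalSpace M] [T2Space M] [SecondCountableTopology M] [ChartedSpace (EuclideanSpace ℝ (Fin 4)) M] [IsManifold (𝓡 4) ((⊤ : ℕ∞) : WithTop ℕ∞) M], (M ≃ₕ (Metric.sphere (0 : EuclideanSpace ℝ (Fin 5)) 1)) → ∀ (k : Fin 3 → ℕ) (T : Fin 3 → Set M), Literature.Topology.FourManifolds.IsGKTrisection M 3 k T → (∀ (g' : ℕ) (k' : Fin 3 → ℕ) (T' : Fin 3 → Set M), Literature.Topology.FourManifolds.IsGKTrisection M g' k' T' → 3 ≤ g') → (let F : Set M := ⋂ l, T l; let H : Fin 3 → Set M := fun p => ⋂ (l : Fin 3) (_ : l ≠ p), T l; let IsCurve : Set M → Prop := fun c => c ⊆ F ∧ ∃ γ : (Metric.sphere (0 : EuclideanSpace ℝ (Fin 2)) 1) → M, Manifold.IsSmoothEmbedding (𝓡 1) (𝓡 4) ((⊤ : ℕ∞) : WithTop ℕ∞) γ ∧ Set.range γ = c; let BoundsDisc : Set M → Set M → Prop := fun A c => ∃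 d : (Metric.closedBall (0 : EuclideanSpace ℝ (Fin 2)) 1) → M, Manifold.IsSmoothEmbedding (𝓡∂ 2) (𝓡 4) ((⊤ : ℕ∞) : WithTop ℕ∞) d ∧ Set.range d ⊆ A ∧ d '' ((𝓡∂ 2).boundary (Metric.closedBall (0 : EuclideanSpace ℝ (Fin 2)) 1)) = c ∧ Set.range d ∩ F = c; let NonSep : Set M → Prop := fun c => IsConnected (F \ c); let DependentTriple : Prop := ∃ (a b c : Set M), IsCurve a ∧ IsCurve b ∧ IsCurve c ∧ Disjoint a b ∧ Disjoint b c ∧ Disjoint a c ∧ NonSep a ∧ NonSep b ∧ NonSep c ∧ BoundsDisc (H 0) a ∧ BoundsDisc (H 1) b ∧ BoundsDisc (H 2) c ∧ ¬ IsPreconnected (F \ (a ∪ b ∪ c)); DependentTriple)) →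
    (∀ (M : Type) [TopologicalSpace M] [T2Space M] [SecondCountableTopology M] [ChartedSpace (EuclideanSpace ℝ (Fin 4)) M] [IsManifold (𝓡 4) ((⊤ : ℕ∞) : WithTop ℕ∞) M], (M ≃ₕ (Metric.sphere (0 : EuclideanSpace ℝ (Fin 5)) 1)) → ∀ (k : Fin 3 → ℕ) (T : Fin 3 → Set M), Literature.Topology.FourManifolds.IsGKTrisection M 3 k T → (let F : Set M := ⋂ l, T l; let H : Fin 3 → Set M := fun p => ⋂ (l : Fin 3) (_ : l ≠ p), T l; let IsCurve : Set M → Prop := fun c => c ⊆ F ∧ ∃ γ : (Metric.sphere (0 : EuclideanSpace ℝ (Fin 2)) 1) → M, Manifold.IsSmoothEmbedding (𝓡 1) (𝓡 4) ((⊤ : ℕ∞) : WithTop ℕ∞) γ ∧ Set.range γ = c; let BoundsDisc : Set M → Set M → Prop := fun A c => ∃ d : (Metric.closedBall (0 : EuclideanSpace ℝ (Fin 2)) 1) → M, Manifold.IsSmoothEmbedding (𝓡∂ 2) (𝓡 4) ((⊤ : ℕ∞) : WithTop ℕ∞) d ∧ Set.range d ⊆ A ∧ d '' ((𝓡∂ 2).boundary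 (Metric.closedBall (0 : EuclideanSpace ℝ (Fin 2)) 1)) = c ∧ Set.range d ∩ F = c; let NonSep : Set M → Prop := fun c => IsConnected (F \ c); let DependentTriple : Prop := ∃ (a b c : Set M), IsCurve a ∧ IsCurve b ∧ IsCurve c ∧ Disjoint a b ∧ Disjoint b c ∧ Disjoint a c ∧ NonSep a ∧ NonSep b ∧ NonSep c ∧ BoundsDisc (H 0) a ∧ BoundsDisc (H 1) b ∧ BoundsDisc (H 2) c ∧ ¬ IsPreconnected (F \ (a ∪ b ∪ c)); DependentTriple) → Nonempty (Diffeomorph (𝓡 4) (𝓡 4) M (Metric.sphere (0 : EuclideanSpace ℝ (Fin 5)) 1) ((⊤ : ℕ∞) : WithTop ℕ∞))) →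
    (∀ (M : Type) [TopologicalSpace M] [T2Space M] [SecondCountableTopology M] [ChartedSpace (EuclideanSpace ℝ (Fin 4)) M] [IsManifold (𝓡 4) ((⊤ : ℕ∞) : WithTop ℕ∞) M], (M ≃ₕ (Metric.sphere (0 : EuclideanSpace ℝ (Fin 5)) 1)) → ∀ (g : ℕ) (k : Fin 3 → ℕ) (T : Fin 3 → Set M), Literature.Topology.FourManifolds.IsGKTrisection M g k T → 4 ≤ g → (∀ (g' : ℕ) (k' : Fin 3 → ℕ) (T' : Fin 3 → Set M), Literature.Topology.FourManifolds.IsGKTrisection M g' k' T' → g ≤ g') → (let F : Set M := ⋂ l, T l; let H : Fin 3 → Set M := fun p => ⋂ (l : Fin 3) (_ : l ≠ p), T l; let IsCurve : Set M → Prop := fun c => c ⊆ F ∧ ∃ γ : (Metric.sphere (0 : EuclideanSpace ℝ (Fin 2)) 1) → M, Manifold.IsSmoothEmbedding (𝓡 1) (𝓡 4) ((⊤ : ℕ∞) : WithTop ℕ∞) γ ∧ Set.range γ = c; let BoundsDisc : Set M → Set M → Prop := fun A c => ∃ d : (Metric.closedBall (0 : EuclideanSpace ℝ (Fin 2)) 1)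 → M, Manifold.IsSmoothEmbedding (𝓡∂ 2) (𝓡 4) ((⊤ : ℕ∞) : WithTop ℕ∞) d ∧ Set.range d ⊆ A ∧ d '' ((𝓡∂ 2).boundary (Metric.closedBall (0 : EuclideanSpace ℝ (Fin 2)) 1)) = c ∧ Set.range d ∩ F = c; let NonSep : Set M → Prop := fun c => IsConnected (F \ c); let WeaklyReducible : Prop := ∃ (p : Fin 3) (c c' : Set M), IsCurve c ∧ IsCurve c' ∧ Disjoint c c' ∧ NonSep c ∧ NonSep c' ∧ BoundsDisc (H p) c ∧ ∀ q : Fin 3, q ≠ p → BoundsDisc (H q) c'; WeaklyReducible)) →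
    -- the crux `MinimalWeaklyReducible`, UNFOLDED verbatim (so that only the closed skeleton theorem
    -- below concludes the crux by name; `MinimalWeaklyReducible_of` re-folds it definitionally)
    (∀ (M : Type) [TopologicalSpace M] [T2Space M] [SecondCountableTopology M] [ChartedSpace (EuclideanSpace ℝ (Fin 4)) M] [IsManifold (𝓡 4) ((⊤ : ℕ∞) : WithTop ℕ∞) M], (M ≃ₕ (Metric.sphere (0 : EuclideanSpace ℝ (Fin 5)) 1)) → ∀ (g : ℕ) (k : Fin 3 → ℕ) (T : Fin 3 → Set M), Literature.Topology.FourManifolds.IsGKTrisection M g k T → 3 ≤ g → (∀ (g' : ℕ) (k' : Fin 3 → ℕ) (T' : Fin 3 → Set M), Literature.Topology.FourManifolds.IsGKTrisection M g' k' T' → g ≤ g') → (let F : Set M := ⋂ l, T l; let H : Fin 3 → Set M := fun p => ⋂ (l : Fin 3) (_ : l ≠ p), T l; let IsCurve : Set M → Prop := fun c => c ⊆ F ∧ ∃ γ : (Metric.sphere (0 : EuclideanSpace ℝ (Fin 2)) 1) → M, Manifold.IsSmoothEmbedding (𝓡 1) (𝓡 4) ((⊤ : ℕ∞) : WithTop ℕ∞)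 γ ∧ Set.range γ = c; let BoundsDisc : Set M → Set M → Prop := fun A c => ∃ d : (Metric.closedBall (0 : EuclideanSpace ℝ (Fin 2)) 1) → M, Manifold.IsSmoothEmbedding (𝓡∂ 2) (𝓡 4) ((⊤ : ℕ∞) : WithTop ℕ∞) d ∧ Set.range d ⊆ A ∧ d '' ((𝓡∂ 2).boundary (Metric.closedBall (0 : EuclideanSpace ℝ (Fin 2)) 1)) = c ∧ Set.range d ∩ F = c; let NonSep : Set M → Prop := fun c => IsConnected (F \ c); let WeaklyReducible : Prop := ∃ (p : Fin 3) (c c' : Set M), IsCurve c ∧ IsCurve c' ∧ Disjoint c c' ∧ NonSep c ∧ NonSep c' ∧ BoundsDisc (H p) c ∧ ∀ q : Fin 3, q ≠ p → BoundsDisc (H q) c'; WeaklyReducible)) := by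
  intro h₁ hF h₂ M _ _ _ _ _ e g k T hT hg hmin
  rcases Nat.lt_or_ge g 4 with hlt | hge
  · obtain rfl : g = 3 := by omega
    have hDT := h₁ M e k T hT hmin
    obtain ⟨Φ⟩ := hF M e k T hT hDT
    exact (not_minimal_of_diffeomorph Φ (by norm_num) hmin).elim
  · exact h₂ M e g k T hT hge hmin

/-- **THE SKELETON THEOREM: the crux `MinimalWeaklyReducible` BY NAME from the three registered stubs.** -/
theorem MinimalWeaklyReducible_of : MinimalWeaklyReducible :=
  minimalWeaklyReducible_of_pieces stub_dependentTripleAtThree stub_dependentTripleStandard stub_fromFour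

/-! ## Exactness: the split loses nothing (modulo the two Aranda–Zupan theorems) -/

/-- `K1 → X₂` (restriction to `g ≥ 4`). [folklore] -/
theorem fromFour_of_minimalWeaklyReducible (h : MinimalWeaklyReducible) :
    ∀ (M : Type) [TopologicalSpace M] [T2Space M] [SecondCountableTopology M] [ChartedSpace (EuclideanSpace ℝ (Fin 4)) M] [IsManifold (𝓡 4) ((⊤ : ℕ∞) : WithTop ℕ∞) M], (M ≃ₕ (Metric.sphere (0 : EuclideanSpace ℝ (Fin 5)) 1)) → ∀ (g : ℕ) (k : Fin 3 → ℕ) (T : Fin 3 → Set M), Literature.Topology.FourManifolds.IsGKTrisection M g k T → 4 ≤ g → (∀ (g' : ℕ) (k' : Fin 3 → ℕ) (T' : Fin 3 → Set M), Literature.Topology.FourManifolds.IsGKTrisection M g' k' T' → g ≤ g') → (let F : Set M := ⋂ l, T l; let H : Fin 3 → Set M := fun p => ⋂ (l : Fin 3) (_ : l ≠ p), T l; let IsCurve : Set M → Prop := fun c => c ⊆ F ∧ ∃ γ : (Metric.sphere (0 : EuclideanSpace ℝ (Fin 2)) 1) → M, Manifold.IsSmoothEmbedding (𝓡 1) (𝓡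 4) ((⊤ : ℕ∞) : WithTop ℕ∞) γ ∧ Set.range γ = c; let BoundsDisc : Set M → Set M → Prop := fun A c => ∃ d : (Metric.closedBall (0 : EuclideanSpace ℝ (Fin 2)) 1) → M, Manifold.IsSmoothEmbedding (𝓡∂ 2) (𝓡 4) ((⊤ : ℕ∞) : WithTop ℕ∞) d ∧ Set.range d ⊆ A ∧ d '' ((𝓡∂ 2).boundary (Metric.closedBall (0 : EuclideanSpace ℝ (Fin 2)) 1)) = c ∧ Set.range d ∩ F = c; let NonSep : Set M → Prop := fun c => IsConnected (F \ c); let WeaklyReducible : Prop := ∃ (p : Fin 3) (c c' : Set M), IsCurve c ∧ IsCurve c' ∧ Disjoint c c' ∧ NonSep c ∧ NonSep c' ∧ BoundsDisc (H p) c ∧ ∀ q : Fin 3, q ≠ p → BoundsDisc (H q) c'; WeaklyReducible) := by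
  intro M _ _ _ _ _ e g k T hT hg hmin
  exact h M e g k T hT (by omega) hmin

/-- `K1 ∧ GenusThreeBase → X₁`: K1 at genus 3 with the route's support `GenusThreeBase` (AZ25 Thm 1.3)
makes `M ≅ S⁴`, contradicting minimality — the rung is EMPTY, so X₁ holds vacuously.  Hence modulo
the two Aranda–Zupan theorems (Thm 1.3 = `GenusThreeBase`, Thm 1.4 = X_F) the crux is EQUIVALENT to
X₁ ∧ X₂. [folklore] -/
theorem dependentTripleAtThree_of_minimalWeaklyReducible (h : MinimalWeaklyReducible) (h4 : GenusThreeBase) :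
    ∀ (M : Type) [TopologicalSpace M] [T2Space M] [SecondCountableTopology M] [ChartedSpace (EuclideanSpace ℝ (Fin 4)) M] [IsManifold (𝓡 4) ((⊤ : ℕ∞) : WithTop ℕ∞) M], (M ≃ₕ (Metric.sphere (0 : EuclideanSpace ℝ (Fin 5)) 1)) → ∀ (k : Fin 3 → ℕ) (T : Fin 3 → Set M), Literature.Topology.FourManifolds.IsGKTrisection M 3 k T → (∀ (g' : ℕ) (k' : Fin 3 → ℕ) (T' : Fin 3 → Set M), Literature.Topology.FourManifolds.IsGKTrisection M g' k' T' → 3 ≤ g') → (let F : Set M := ⋂ l, T l; let H : Fin 3 → Set M := fun p => ⋂ (l : Fin 3) (_ : l ≠ p), T l; let IsCurve : Set M → Prop := fun c => c ⊆ F ∧ ∃ γ : (Metric.sphere (0 : EuclideanSpace ℝ (Fin 2)) 1) → M, Manifold.IsSmoothEmbedding (𝓡 1) (𝓡 4) ((⊤ : ℕ∞) : WithTop ℕ∞) γ ∧ Set.range γ = c; let BoundsDisc : Set M → Set M → Prop := fun A c => ∃ d : (Metric.closedBall (0 : EuclideanSpace ℝ (Fin 2)) 1) → M, Manifold.IsSmoothEmbedding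 (𝓡∂ 2) (𝓡 4) ((⊤ : ℕ∞) : WithTop ℕ∞) d ∧ Set.range d ⊆ A ∧ d '' ((𝓡∂ 2).boundary (Metric.closedBall (0 : EuclideanSpace ℝ (Fin 2)) 1)) = c ∧ Set.range d ∩ F = c; let NonSep : Set M → Prop := fun c => IsConnected (F \ c); let DependentTriple : Prop := ∃ (a b c : Set M), IsCurve a ∧ IsCurve b ∧ IsCurve c ∧ Disjoint a b ∧ Disjoint b c ∧ Disjoint a c ∧ NonSep a ∧ NonSep b ∧ NonSep c ∧ BoundsDisc (H 0) a ∧ BoundsDisc (H 1) b ∧ BoundsDisc (H 2) c ∧ ¬ IsPreconnected (F \ (a ∪ b ∪ c)); DependentTriple) := by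
  intro M _ _ _ _ _ e k T hT hmin
  have hwr := h M e 3 k T hT le_rfl hmin
  obtain ⟨Φ⟩ := h4 M e k T hT hwr
  exact (not_minimal_of_diffeomorph Φ (by norm_num) hmin).elim

end Summit.SmoothPoincare4.SmoothPoincare4.Cruxes.MinimalWeaklyReducible.RungSplit

end
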